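import Summits.ResolutionOfSingularities.ResolutionOfSingularities.Theorems.UniformComplexityCampaignW82AlgClosureFgKernel
import Summits.ResolutionOfSingularities.ResolutionOfSingularities.Theorems.UniformComplexityCampaignW82PerfectionStepAlgClosedRungs
import HarnessLib

/-!
# Slot W8.2, door 2: LOW RUNGS of the finite-trdeg residuals `CampaignW82.PerfectionStepAlgClosureFgDimLe`
# and `CampaignW82.ClimbRatFuncPerfAlgClosureFgDimLe` (`n ≤ 1` unconditional, `n ≤ 3` from `CossartPiltant2019`)

Theses-free module (imports the lane-signed OURS vocabulary `…CampaignW82AlgClosureFgKernel`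
(typer res-L1-type-o6, p475047) and the door-2 rungs at all algebraically closed constant fields
`…CampaignW82PerfectionStepAlgClosedRungs` (p475542)). It transfers the rung table of door 2 to the
finite-transcendence-degree names — the perfection step / graded kernel at the constant fields
`M = (closure s)^{alg} ∩ K`, `K` algebraically closed of characteristic `p`, `s ⊆ K` finite — through
the typer's anchors `perfectionStepAlgClosureFgDimLe_of_perfectionStepAlgClosedDimLe` and
`climbRatFuncPerfAlgClosureFgDimLe_of_climbRatFuncPerfAlgClosedDimLe` (pure logic):

* `n ≤ 1` UNCONDITIONAL: `perfectionStepAlgClosureFgDimLe_of_le_one`,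
  `climbRatFuncPerfAlgClosureFgDimLe_of_le_one`;
* `n ≤ 3` CONDITIONAL on the named fact `Literature.AlgebraicGeometry.Resolution.CossartPiltant2019`
  (F-02; taken as a hypothesis): `perfectionStepAlgClosureFgDimLe_of_le_three`,
  `climbRatFuncPerfAlgClosureFgDimLe_of_le_three`.

So the first open grade of the sharpest door-2 residual is `PerfectionStepAlgClosureFgDimLe p 4`
(fibre dimension `4` over `𝔽̄_p(t)^{perf}`, constant field `𝔽̄_p = (closure ∅)^{alg} ∩ K`). The rungs are
logically idle with respect to the slot's lever (the constant field is not used).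

[OURS · LADDER-RESOLUTION L1, slot W8.2 (prime-field / universality transfer), door 2
UniformComplexity] Pure-logic rungs of OURS statements over the summit's own route; NOT statements of,
and attributing nothing to, Hironaka's 2017 manuscript. [cite: CossartPiltant2019, Thm. 1.1]
-/

noncomputable section

set_option linter.dupNamespace false -- mandated namespace of this single-conjunct summit

open CategoryTheory CategoryTheory.Limits AlgebraicGeometry
open Literature.AlgebraicGeometry.Resolution

namespace Summit.ResolutionOfSingularities.ResolutionOfSingularities.Theorems.CampaignW82

/-- **The finite-trdeg perfection step in fibre dimension `≤ 1` holds outright** (hypothesis idle;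
curves are resolved by normalisation). [folklore] -/
theorem perfectionStepAlgClosureFgDimLe_of_le_one (p : ℕ) {n : WithBot ℕ∞} (hn : n ≤ 1) :
    PerfectionStepAlgClosureFgDimLe p n :=
  perfectionStepAlgClosureFgDimLe_of_perfectionStepAlgClosedDimLe
    (perfectionStepAlgClosedDimLe_of_le_one p hn)

/-- **The finite-trdeg graded kernel at `(m, n)` with `n ≤ 1` holds outright.** [folklore] -/
theorem climbRatFuncPerfAlgClosureFgDimLe_of_le_one (p : ℕ) (m : WithBot ℕ∞) {n : WithBot ℕ∞}
    (hn : n ≤ 1) : ClimbRatFuncPerfAlgClosureFgDimLe p m n :=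
  climbRatFuncPerfAlgClosureFgDimLe_of_climbRatFuncPerfAlgClosedDimLe
    (climbRatFuncPerfAlgClosedDimLe_of_le_one p m hn)

/-- **The finite-trdeg perfection step in fibre dimension `≤ 3`, from `CossartPiltant2019`** (taken
as a hypothesis). [cite: CossartPiltant2019, Thm. 1.1] -/
theorem perfectionStepAlgClosureFgDimLe_of_le_three (hCP : CossartPiltant2019.{0}) (p : ℕ)
    {n : WithBot ℕ∞} (hn : n ≤ 3) : PerfectionStepAlgClosureFgDimLe p n :=
  perfectionStepAlgClosureFgDimLe_of_perfectionStepAlgClosedDimLe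
    (perfectionStepAlgClosedDimLe_of_le_three hCP p hn)

/-- **The finite-trdeg graded kernel at `(m, n)` with `n ≤ 3`, from `CossartPiltant2019`.**
[cite: CossartPiltant2019, Thm. 1.1] -/
theorem climbRatFuncPerfAlgClosureFgDimLe_of_le_three (hCP : CossartPiltant2019.{0}) (p : ℕ)
    (m : WithBot ℕ∞) {n : WithBot ℕ∞} (hn : n ≤ 3) : ClimbRatFuncPerfAlgClosureFgDimLe p m n :=
  climbRatFuncPerfAlgClosureFgDimLe_of_climbRatFuncPerfAlgClosedDimLe
    (climbRatFuncPerfAlgClosedDimLe_of_le_three hCP p m hn)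

end Summit.ResolutionOfSingularities.ResolutionOfSingularities.Theorems.CampaignW82

end
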